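import Literature.NumberTheory.LFunctions.ZetaScrew
import Mathlib.Analysis.SpecialFunctions.Trigonometric.DerivHyp
import HarnessLib

/-!
# Suzuki (2023), Theorem 4.2 — the local screw property of `g = -Ψ` (proof)

This file discharges the named fact `Suzuki2023_thm42_screw` of
`Literature/NumberTheory/LFunctions/ZetaScrew.lean` (the sibling `ZetaScrewProofs.lean`
discharges Thm 1.1 (1) by Fourier analysis; the present proof is independent of it and
elementary, so it is kept in its own file):

`theorem Suzuki2023_thm42_screw_holds : Suzuki2023_thm42_screw`, i.e. there is `a₀ > 0` such that
for every `0 < a < a₀` the kernel `G_g(t,u) = Ψ(t) + Ψ(u) - Ψ(t - u)` of `g = -Ψ` (Suzuki's screw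
function of `ζ`, `zetaScrew`) is non-negative definite on `(-a, a)` in the sense of Suzuki2023
(1.5) (`IsPosSemidefKernelOn`), i.e. `g|_{[-2a,2a]} ∈ 𝒢_a` — the "in particular" clause of
M. Suzuki, *Aspects of the screw function corresponding to the Riemann zeta-function*,
J. Lond. Math. Soc. 108 (2023), Thm 4.2 (arXiv:2206.03682, §4.3).

## The printed proof and the proof given here

Suzuki proves the stronger first clause of Thm 4.2 (positive definiteness of the hermitian form
`⟨φ, φ⟩_{G_g,a}` on `L²(-a,a)`) by splitting `g = g₀ + g₁ + g_∞` (pole part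
`g₀ = -4(e^{t/2} + e^{-t/2} - 2)`, prime part `g₁`, archimedean part `g_∞`), writing the three
forms as integrals of `|Φ₁(φ; z)|²` against `1/(s-1) + 1/s`, `ζ'/ζ(s)` (on `Re s = 1 + c`) and
`Re[(1/2)(Γ'/Γ)(s/2)] - (1/2) log π` (on the real line), and showing that for small `a` the
archimedean part is coercive (`Re (Γ'/Γ) ~ log |z| → ∞`) and dominates the other two
(Suzuki2023, pp. 1461–1463 of the journal version / pp. 8–10 of the arXiv version).

For the finite-configuration statement vendored in the tree we run the SAME MECHANISM on the
"time side", where everything is elementary (finite sums, interval integrals of step functions,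
Cauchy–Schwarz), so that no Fourier analysis, contour integration or digamma asymptotics is
needed. By the bridge `isPosSemidefKernelOn_zetaScrewKernel_iff` it suffices to treat real
coefficients; augmenting a configuration `t₁, …, t_N ∈ (-a,a)` by `t₀ = 0` with weight `-∑ xᵢ`
turns `∑ᵢⱼ G_g(tᵢ,tⱼ) xᵢ xⱼ` into `-∑ᵢⱼ wᵢ wⱼ Ψ(sᵢ - sⱼ)` with `∑ wᵢ = 0`
(`sum_sum_zetaScrewKernel_eq_neg`), so the claim is that `Ψ` is *conditionally negative
definite* on small configurations. For `a ≤ (log 2)/2` all differences lie on the prime-free wall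
`|v| < log 2` (`zetaScrew_eq_of_abs_lt_log_two`: `g₁` does not contribute), where

`Ψ(v) = 8(cosh(v/2) - 1) - (A/2)|v| + ∑_{k ≥ 0} (1 - e^{-λ_k |v|})/λ_k²`,
`λ_k = 2k + 1/2`, `A = γ₀ + π/2 + 3 log 2 + log π` (`zetaScrew_eq_cosh_tsum`; this is (1.1) with
`(1/4)(C - e^{-|v|/2} Φ(e^{-2|v|}, 2, 1/4)) = ∑_k (1 - e^{-λ_k|v|})/λ_k²`).

With the step function `H(u) = ∑ᵢ wᵢ 1[u ≤ sᵢ]` and its energy `E = ∫_{-a}^{a} H² ≥ 0`: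

* pole part: `∑ᵢⱼ wᵢwⱼ 8(cosh((sᵢ-sⱼ)/2) - 1) = 8(∑ wᵢ(cosh(sᵢ/2) - 1))² - 8(∑ wᵢ sinh(sᵢ/2))²`
  and, by summation by parts `∑ wᵢ g(sᵢ) = ∫ g' H` and Cauchy–Schwarz,
  `8(∑ wᵢ(cosh(sᵢ/2) - 1))² ≤ a e^a E ≤ (log 2) E` (`cosh_term_le`);
* linear part: `∑ᵢⱼ wᵢwⱼ |sᵢ - sⱼ| = -2E` (`sum_sum_mul_abs_sub_eq`), contributing `+A·E`;
* archimedean part (the coercive one): by Pólya's decomposition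
  `e^{-λ|v|} = e^{-2aλ}(1 + 2aλ) - λe^{-2aλ}|v| + ∫_0^{2a} (r - |v|)₊ λ² e^{-λr} dr` (`|v| ≤ 2a`)
  and positive definiteness of the triangle functions `(r - |v|)₊` (autocorrelations of
  indicators), `∑ᵢⱼ wᵢwⱼ e^{-λ_k|sᵢ-sⱼ|} ≥ 2λ_k e^{-2aλ_k} E` (`sum_sum_mul_exp_ge`), whence
  `∑_k λ_k^{-2} ∑ᵢⱼ wᵢwⱼ e^{-λ_k|sᵢ-sⱼ|} ≥ (∑_{k<K} 2/λ_k - 4aK) E` for every `K`.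

Hence `∑ᵢⱼ wᵢwⱼ Ψ(sᵢ - sⱼ) ≤ (log 2 + A - ∑_{k<K} 2/λ_k + 4aK) E ≤ 0` once
`∑_{k<K} 2/λ_k ≥ A + 2` (possible since `∑ 1/λ_k` diverges — this divergence is the time-side
shadow of `Re (Γ'/Γ)(1/4 - iz/2) → +∞`) and `a ≤ min((log 2)/2, 1/(4(K+1)))`
(`sum_sum_mul_zetaScrew_nonpos`).

All auxiliary statements live in the sub-namespace `Suzuki2023Thm42`; only
`Suzuki2023_thm42_screw_holds` is meant to be used elsewhere.

## References

* M. Suzuki, *Aspects of the screw function corresponding to the Riemann zeta-function*,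
  J. Lond. Math. Soc. (2) 108 (2023), no. 4, 1448–1487; arXiv:2206.03682, Thm 4.2 and §4.3.
  [Suzuki2023]
* G. Pólya, *Remarks on characteristic functions*, Proc. Berkeley Sympos. (1949) (convex even
  functions vanishing at infinity are positive definite; here only the explicit triangle
  decomposition of `e^{-λ|v|}` is used). [folklore]
-/

noncomputable section

open scoped Topology BigOperators
open MeasureTheory Set

namespace Literature.NumberTheory.LFunctions

namespace Suzuki2023Thm42

/-! ### `Ψ` on the wall and the augmentation trick -/

/-- On the wall `|v| < log 2`, `Ψ` in "spectral" form:
`Ψ(v) = 8(cosh(v/2) - 1) - (A/2)|v| + ∑_k (1 - e^{-λ_k |v|})/λ_k²`, `λ_k = 2k + 1/2`,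
`A = γ₀ + π/2 + 3 log 2 + log π` (Suzuki2023 (1.1) with the Hurwitz–Lerch term summed termwise:
`(1/4)((k + 1/4)^{-2} - e^{-|v|/2} e^{-2|v|k} (k + 1/4)^{-2}) = (1 - e^{-λ_k|v|})/λ_k²`).
[cite: Suzuki2023, (1.1) and proof of Thm 4.1] -/
theorem zetaScrew_eq_cosh_tsum {v : ℝ} (hv : |v| < Real.log 2) :
    zetaScrew v = 8 * (Real.cosh (v / 2) - 1)
      - (Real.eulerMascheroniConstant + Real.pi / 2 + 3 * Real.log 2 + Real.log Real.pi) / 2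
          * |v|
      + ∑' k : ℕ, (1 - Real.exp (-((2 * k + 1 / 2) * |v|))) / (2 * (k : ℝ) + 1 / 2) ^ 2 := by
  rw [zetaScrew_eq_of_abs_lt_log_two hv, hurwitzLerchQuarter]
  have hcosh : Real.exp (|v| / 2) + Real.exp (-(|v| / 2)) - 2 = 2 * (Real.cosh (v / 2) - 1) := by
    rw [← Real.cosh_abs (v / 2), Real.cosh_eq, abs_div, abs_two]
    ring
  rw [hcosh, ← tsum_mul_left, ← (summable_one_div_nat_add_quarter_sq).tsum_sub
    ((summable_hurwitzLerchQuarter v).mul_left _), ← tsum_mul_left]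
  have hterm : ∀ k : ℕ, (1 / 4 : ℝ) * (1 / ((k : ℝ) + 1 / 4) ^ 2
      - Real.exp (-(|v| / 2)) * (Real.exp (-(2 * |v| * k)) / ((k : ℝ) + 1 / 4) ^ 2))
      = (1 - Real.exp (-((2 * k + 1 / 2) * |v|))) / (2 * (k : ℝ) + 1 / 2) ^ 2 := by
    intro k
    have hk : (2 * (k : ℝ) + 1 / 2) ^ 2 = 4 * ((k : ℝ) + 1 / 4) ^ 2 := by ring
    have hk0 : ((k : ℝ) + 1 / 4) ^ 2 ≠ 0 := by positivity
    rw [hk, show Real.exp (-((2 * k + 1 / 2) * |v|))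
        = Real.exp (-(|v| / 2)) * Real.exp (-(2 * |v| * k)) by rw [← Real.exp_add]; ring_nf]
    field_simp
  rw [tsum_congr hterm]
  ring

/-- Augmentation: the real quadratic form of the kernel `G(t,u) = Ψ(t) + Ψ(u) - Ψ(t - u)` over
`t₁, …, t_N` equals `-∑_{i,j=0}^{N} x'ᵢ x'ⱼ Ψ(t'ᵢ - t'ⱼ)` for the configuration augmented by
`t'₀ = 0` with weight `x'₀ = -∑ xᵢ` (so that `∑ x' = 0`; uses `Ψ(0) = 0` and `Ψ` even).
[folklore] -/
theorem sum_sum_zetaScrewKernel_eq_neg {N : ℕ} (t x : Fin N → ℝ) :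
    ∑ i, ∑ j, zetaScrewKernel (t i) (t j) * (x i * x j) =
      -∑ i : Fin (N + 1), ∑ j : Fin (N + 1),
        (Fin.cons (-∑ i, x i) x : Fin (N + 1) → ℝ) i
          * (Fin.cons (-∑ i, x i) x : Fin (N + 1) → ℝ) j
          * zetaScrew
            ((Fin.cons 0 t : Fin (N + 1) → ℝ) i - (Fin.cons 0 t : Fin (N + 1) → ℝ) j) := by
  simp only [Fin.sum_univ_succ, Fin.cons_zero, Fin.cons_succ, zetaScrew_zero, mul_zero,
    zero_add, zero_sub, zetaScrew_neg, sub_zero, zetaScrewKernel]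
  have h1 : ∑ i, ∑ j, (zetaScrew (t i) + zetaScrew (t j) - zetaScrew (t i - t j)) * (x i * x j)
      = (∑ i, zetaScrew (t i) * x i) * (∑ j, x j) + (∑ i, x i) * (∑ j, zetaScrew (t j) * x j)
        - ∑ i, ∑ j, x i * x j * zetaScrew (t i - t j) := by
    have e1 : ∀ i j, (zetaScrew (t i) + zetaScrew (t j) - zetaScrew (t i - t j)) * (x i * x j)
        = zetaScrew (t i) * x i * x j + x i * (zetaScrew (t j) * x j)
          - x i * x j * zetaScrew (t i - t j) := by
      intros; ring
    simp only [e1, Finset.sum_add_distrib, Finset.sum_sub_distrib, Finset.sum_mul_sum]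
  have h2 : ∑ j, -(∑ i, x i) * x j * zetaScrew (t j)
      = -(∑ i, x i) * ∑ j, zetaScrew (t j) * x j := by
    rw [Finset.mul_sum]
    refine Finset.sum_congr rfl fun j _ => ?_
    ring
  have h3 : ∀ i, x i * -(∑ i, x i) * zetaScrew (t i)
      = -(∑ i, x i) * (zetaScrew (t i) * x i) := by
    intro i; ring
  simp only [h3]
  rw [h1, h2, Finset.sum_add_distrib, ← Finset.mul_sum]
  ring

/-! ### Step functions `u ↦ ∑ᵢ wᵢ 1[u ≤ sᵢ]` and their integrals -/

/-- A bounded measurable real function is interval integrable. [folklore] -/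
theorem intervalIntegrable_of_abs_le {φ : ℝ → ℝ} (hφ : Measurable φ) {M : ℝ}
    (hM : ∀ u, |φ u| ≤ M) (x y : ℝ) : IntervalIntegrable φ volume x y := by
  constructor <;>
    exact IntegrableOn.of_bound measure_Ioc_lt_top hφ.aestronglyMeasurable M
      (ae_of_all _ fun u => by rw [Real.norm_eq_abs]; exact hM u)

/-- Measurability of `u ↦ if u ≤ p then c else 0`. [folklore] -/
theorem measurable_ite_le (p c : ℝ) : Measurable fun u : ℝ => if u ≤ p then c else 0 :=
  Measurable.ite measurableSet_Iic measurable_const measurable_const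

/-- The step function `H(u) = ∑ᵢ wᵢ 1[u ≤ sᵢ]` is measurable. [folklore] -/
theorem measurable_stepSum {m : ℕ} (s w : Fin m → ℝ) :
    Measurable fun u : ℝ => ∑ i, (if u ≤ s i then w i else 0) :=
  Finset.measurable_sum _ fun i _ => measurable_ite_le (s i) (w i)

/-- `|∑ᵢ wᵢ 1[u ≤ sᵢ]| ≤ ∑ᵢ |wᵢ|`. [folklore] -/
theorem abs_stepSum_le {m : ℕ} (s w : Fin m → ℝ) (u : ℝ) :
    |∑ i, (if u ≤ s i then w i else 0)| ≤ ∑ i, |w i| := by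
  refine (Finset.abs_sum_le_sum_abs _ _).trans (Finset.sum_le_sum fun i _ => ?_)
  split_ifs
  · exact le_rfl
  · rw [abs_zero]; exact abs_nonneg _

/-- The step function is interval integrable. [folklore] -/
theorem intervalIntegrable_stepSum {m : ℕ} (s w : Fin m → ℝ) (x y : ℝ) :
    IntervalIntegrable (fun u : ℝ => ∑ i, (if u ≤ s i then w i else 0)) volume x y :=
  intervalIntegrable_of_abs_le (measurable_stepSum s w) (abs_stepSum_le s w) x y

/-- The square of the step function is interval integrable. [folklore] -/
theorem intervalIntegrable_stepSum_sq {m : ℕ} (s w : Fin m → ℝ) (x y : ℝ) :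
    IntervalIntegrable (fun u : ℝ => (∑ i, (if u ≤ s i then w i else 0)) ^ 2) volume x y := by
  refine intervalIntegrable_of_abs_le ((measurable_stepSum s w).pow_const 2)
    (M := (∑ i, |w i|) ^ 2) (fun u => ?_) x y
  rw [abs_pow]
  exact pow_le_pow_left₀ (abs_nonneg _) (abs_stepSum_le s w u) 2

/-- Finite sums of interval integrable functions, in `fun` form. [folklore] -/
theorem intervalIntegrable_sum_fun {ι : Type*} (S : Finset ι) {f : ι → ℝ → ℝ} {x y : ℝ}
    (h : ∀ i ∈ S, IntervalIntegrable (f i) volume x y) :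
    IntervalIntegrable (fun u => ∑ i ∈ S, f i u) volume x y := by
  have hfun : (fun u => ∑ i ∈ S, f i u) = ∑ i ∈ S, f i := by
    funext u
    exact (Finset.sum_apply u S f).symm
  rw [hfun]
  exact IntervalIntegrable.sum S h

/-- Product of two step indicators: `1[u ≤ p] 1[u ≤ q] = 1[u ≤ min p q]`. [folklore] -/
theorem ite_le_mul_ite_le (p q u : ℝ) :
    (if u ≤ p then (1 : ℝ) else 0) * (if u ≤ q then 1 else 0)
      = if u ≤ min p q then 1 else 0 := by
  by_cases h1 : u ≤ p <;> by_cases h2 : u ≤ q <;> simp [h1, h2]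

/-- `∫_{-a}^{a} 1[u ≤ p] du = p + a` for `-a ≤ p ≤ a`. [folklore] -/
theorem integral_ite_le {a p : ℝ} (h₁ : -a ≤ p) (h₂ : p ≤ a) :
    ∫ u in (-a)..a, (if u ≤ p then (1 : ℝ) else 0) = p + a := by
  have hfun : (fun u : ℝ => if u ≤ p then (1 : ℝ) else 0) = (Set.Iic p).indicator 1 := by
    funext u
    by_cases h : u ≤ p <;> simp [h]
  rw [hfun, intervalIntegral.integral_of_le (h₁.trans h₂), setIntegral_indicator measurableSet_Iic,
    Set.Ioc_inter_Iic, Pi.one_def, setIntegral_const, min_eq_right h₂,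
    Real.volume_real_Ioc_of_le h₁, smul_eq_mul, mul_one]
  ring

/-- **Summation by parts** against the step function: if `∑ wᵢ = 0` and `|sᵢ| ≤ a` then
`∑ᵢ wᵢ g(sᵢ) = ∫_{-a}^{a} g'(u) (∑ᵢ wᵢ 1[u ≤ sᵢ]) du` for `g` with continuous derivative `g'`.
[folklore] -/
theorem sum_mul_eq_integral_deriv_mul_stepSum {m : ℕ} {a : ℝ} (s w : Fin m → ℝ)
    (hs : ∀ i, |s i| ≤ a) (hw : ∑ i, w i = 0) {g g' : ℝ → ℝ}
    (hg : ∀ u, HasDerivAt g (g' u) u) (hg' : Continuous g') :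
    ∑ i, w i * g (s i) = ∫ u in (-a)..a, g' u * ∑ i, (if u ≤ s i then w i else 0) := by
  have ha : ∀ i, -a ≤ s i ∧ s i ≤ a := fun i => abs_le.1 (hs i)
  have hterm : ∀ i, ∫ u in (-a)..a, g' u * (if u ≤ s i then w i else 0)
      = w i * (g (s i) - g (-a)) := by
    intro i
    have hfun : (fun u => g' u * (if u ≤ s i then w i else 0))
        = (Set.Iic (s i)).indicator (fun u => g' u * w i) := by
      funext u
      by_cases h : u ≤ s i <;> simp [h]
    rw [hfun, intervalIntegral.integral_of_le ((ha i).1.trans (ha i).2),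
      setIntegral_indicator measurableSet_Iic, Set.Ioc_inter_Iic, min_eq_right (ha i).2,
      ← intervalIntegral.integral_of_le (ha i).1, intervalIntegral.integral_mul_const,
      intervalIntegral.integral_eq_sub_of_hasDerivAt (fun u _ => hg u) (hg'.intervalIntegrable _ _)]
    ring
  calc ∑ i, w i * g (s i) = ∑ i, w i * (g (s i) - g (-a)) := by
        rw [← sub_eq_zero, ← Finset.sum_sub_distrib]
        have e : ∀ i, w i * g (s i) - w i * (g (s i) - g (-a)) = w i * g (-a) := fun i => by ring
        simp_rw [e]
        rw [← Finset.sum_mul, hw, zero_mul]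
    _ = ∑ i, ∫ u in (-a)..a, g' u * (if u ≤ s i then w i else 0) := by simp_rw [hterm]
    _ = ∫ u in (-a)..a, ∑ i, g' u * (if u ≤ s i then w i else 0) := by
        rw [intervalIntegral.integral_finsetSum]
        exact fun i _ =>
          (intervalIntegrable_of_abs_le (measurable_ite_le (s i) (w i)) (M := |w i|)
            (fun u => by split_ifs <;> simp) _ _).continuousOn_mul hg'.continuousOn
    _ = ∫ u in (-a)..a, g' u * ∑ i, (if u ≤ s i then w i else 0) := by
        simp_rw [Finset.mul_sum]

/-- **Cauchy–Schwarz** for interval integrals (via the discriminant of `c ↦ ∫ (c f - g)²`).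
[folklore] -/
theorem sq_integral_mul_le {x y : ℝ} (hxy : x ≤ y) {f g : ℝ → ℝ}
    (hf2 : IntervalIntegrable (fun u => f u ^ 2) volume x y)
    (hg2 : IntervalIntegrable (fun u => g u ^ 2) volume x y)
    (hfg : IntervalIntegrable (fun u => f u * g u) volume x y) :
    (∫ u in x..y, f u * g u) ^ 2 ≤ (∫ u in x..y, f u ^ 2) * ∫ u in x..y, g u ^ 2 := by
  have key : ∀ c : ℝ, 0 ≤ (∫ u in x..y, f u ^ 2) * (c * c)
      + (-2 * ∫ u in x..y, f u * g u) * c + ∫ u in x..y, g u ^ 2 := by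
    intro c
    have h : (∫ u in x..y, f u ^ 2) * (c * c) + (-2 * ∫ u in x..y, f u * g u) * c
        + ∫ u in x..y, g u ^ 2 = ∫ u in x..y, (c * f u - g u) ^ 2 := by
      have e : (fun u => (c * f u - g u) ^ 2)
          = fun u => ((c * c) * f u ^ 2 - (2 * c) * (f u * g u)) + g u ^ 2 := by
        funext u; ring
      rw [e, intervalIntegral.integral_add ((hf2.const_mul _).sub (hfg.const_mul _)) hg2,
        intervalIntegral.integral_sub (hf2.const_mul _) (hfg.const_mul _),
        intervalIntegral.integral_const_mul, intervalIntegral.integral_const_mul]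
      ring
    rw [h]
    exact intervalIntegral.integral_nonneg hxy fun u _ => sq_nonneg _
  have hd := discrim_le_zero key
  rw [discrim] at hd
  nlinarith [hd]

/-- Double sums against weights of total mass zero kill functions of the first index.
[folklore] -/
theorem sum_sum_mul_mul_eq_zero_left {m : ℕ} (w : Fin m → ℝ) (hw : ∑ i, w i = 0)
    (f : Fin m → ℝ) : ∑ i, ∑ j, w i * w j * f i = 0 := by
  have h : ∀ i, ∑ j, w i * w j * f i = w i * f i * ∑ j, w j := fun i => by
    rw [Finset.mul_sum]
    exact Finset.sum_congr rfl fun j _ => by ring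
  simp_rw [h, hw, mul_zero, Finset.sum_const_zero]

/-- Double sums against weights of total mass zero kill functions of the second index.
[folklore] -/
theorem sum_sum_mul_mul_eq_zero_right {m : ℕ} (w : Fin m → ℝ) (hw : ∑ i, w i = 0)
    (f : Fin m → ℝ) : ∑ i, ∑ j, w i * w j * f j = 0 := by
  rw [Finset.sum_comm]
  have h : ∀ j, ∑ i, w i * w j * f j = w j * f j * ∑ i, w i := fun j => by
    rw [Finset.mul_sum]
    exact Finset.sum_congr rfl fun i _ => by ring
  simp_rw [h, hw, mul_zero, Finset.sum_const_zero]

/-- The **energy identity**: for `∑ wᵢ = 0` and `|sᵢ| ≤ a`,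
`∑ᵢⱼ wᵢ wⱼ |sᵢ - sⱼ| = -2 ∫_{-a}^{a} (∑ᵢ wᵢ 1[u ≤ sᵢ])² du`
(`|p - q| = p + q - 2 min(p,q)` and `min(p,q) + a = ∫_{-a}^{a} 1[u ≤ p] 1[u ≤ q] du`; this is
the conditional negative definiteness of `|t|`, i.e. the kernel `K(t,u) = (|t| + |u| - |t-u|)/2`
of Suzuki2023 (4.3)). [folklore] -/
theorem sum_sum_mul_abs_sub_eq {m : ℕ} {a : ℝ} (s w : Fin m → ℝ) (hs : ∀ i, |s i| ≤ a)
    (hw : ∑ i, w i = 0) :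
    ∑ i, ∑ j, w i * w j * |s i - s j|
      = -2 * ∫ u in (-a)..a, (∑ i, (if u ≤ s i then w i else 0)) ^ 2 := by
  have ha : ∀ i, -a ≤ s i ∧ s i ≤ a := fun i => abs_le.1 (hs i)
  have habs : ∀ p q : ℝ, |p - q| = p + q - 2 * min p q := fun p q => by
    rcases le_total p q with h | h
    · rw [min_eq_left h, abs_of_nonpos (sub_nonpos.2 h)]; ring
    · rw [min_eq_right h, abs_of_nonneg (sub_nonneg.2 h)]; ring
  have hsq : ∀ u : ℝ, (∑ i, (if u ≤ s i then w i else 0)) ^ 2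
      = ∑ i, ∑ j, w i * w j * (if u ≤ min (s i) (s j) then (1 : ℝ) else 0) := by
    intro u
    rw [sq, Finset.sum_mul_sum]
    refine Finset.sum_congr rfl fun i _ => Finset.sum_congr rfl fun j _ => ?_
    rw [← ite_le_mul_ite_le]
    by_cases hi : u ≤ s i <;> by_cases hj : u ≤ s j <;> simp [hi, hj]
  have hI : ∫ u in (-a)..a, (∑ i, (if u ≤ s i then w i else 0)) ^ 2
      = ∑ i, ∑ j, w i * w j * (min (s i) (s j) + a) := by
    simp_rw [hsq]
    rw [intervalIntegral.integral_finsetSum (fun i _ => intervalIntegrable_sum_fun _ fun j _ =>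
      (intervalIntegrable_of_abs_le (measurable_ite_le _ _) (M := 1)
        (fun u => by split_ifs <;> simp) _ _).const_mul _)]
    refine Finset.sum_congr rfl fun i _ => ?_
    rw [intervalIntegral.integral_finsetSum (fun j _ =>
      (intervalIntegrable_of_abs_le (measurable_ite_le _ _) (M := 1)
        (fun u => by split_ifs <;> simp) _ _).const_mul _)]
    refine Finset.sum_congr rfl fun j _ => ?_
    rw [intervalIntegral.integral_const_mul,
      integral_ite_le (le_min (ha i).1 (ha j).1) ((min_le_left _ _).trans (ha i).2)]
  have e1 : ∀ i j, w i * w j * |s i - s j|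
      = w i * w j * s i + w i * w j * s j + (-2) * (w i * w j * min (s i) (s j)) := by
    intro i j; rw [habs]; ring
  have e2 : ∀ i j, w i * w j * (min (s i) (s j) + a)
      = w i * w j * min (s i) (s j) + w i * w j * a := by
    intro i j; ring
  simp_rw [hI, e1, e2, Finset.sum_add_distrib, sum_sum_mul_mul_eq_zero_left w hw,
    sum_sum_mul_mul_eq_zero_right w hw, ← Finset.mul_sum]
  ring

/-! ### Pólya: `e^{-λ|v|}` on `[-b, b]` = tangent line at `b` + a mixture of triangles -/

/-- For `|v| ≤ b`:
`e^{-λ|v|} = e^{-λb}(1 + λb) - λ e^{-λb} |v| + ∫_0^b (r - |v|)₊ λ² e^{-λr} dr`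
(Taylor's formula at `b` with integral remainder; the remainder is a non-negative mixture of the
triangle functions `(r - |v|)₊`, as in Pólya's criterion). [folklore] -/
theorem exp_neg_mul_abs_eq_integral {lam b v : ℝ} (hv : |v| ≤ b) :
    Real.exp (-(lam * |v|)) = Real.exp (-(lam * b)) * (1 + lam * b)
      - lam * Real.exp (-(lam * b)) * |v|
      + ∫ r in (0 : ℝ)..b, max (r - |v|) 0 * (lam ^ 2 * Real.exp (-(lam * r))) := by
  set c := |v| with hc
  have hc0 : 0 ≤ c := abs_nonneg v
  have hcont : Continuous fun r : ℝ => max (r - c) 0 * (lam ^ 2 * Real.exp (-(lam * r))) := by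
    fun_prop
  rw [← intervalIntegral.integral_add_adjacent_intervals (b := c) (hcont.intervalIntegrable _ _)
    (hcont.intervalIntegrable _ _)]
  have hz : ∫ r in (0 : ℝ)..c, max (r - c) 0 * (lam ^ 2 * Real.exp (-(lam * r))) = 0 := by
    rw [intervalIntegral.integral_congr (g := fun _ => (0 : ℝ)) ?_, intervalIntegral.integral_zero]
    intro r hr
    rw [Set.uIcc_of_le hc0] at hr
    simp [max_eq_right (sub_nonpos.2 hr.2)]
  have hmain : ∫ r in c..b, max (r - c) 0 * (lam ^ 2 * Real.exp (-(lam * r)))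
      = ∫ r in c..b, (r - c) * (lam ^ 2 * Real.exp (-(lam * r))) := by
    refine intervalIntegral.integral_congr fun r hr => ?_
    rw [Set.uIcc_of_le hv] at hr
    simp [max_eq_left (sub_nonneg.2 hr.1)]
  have he : ∀ r : ℝ, HasDerivAt (fun r => Real.exp (-(lam * r)))
      (Real.exp (-(lam * r)) * -lam) r := by
    intro r
    have h := ((hasDerivAt_id r).const_mul (-lam)).exp
    simpa only [id_eq, neg_mul, mul_one] using h
  have hderiv : ∀ r ∈ Set.uIcc c b,
      HasDerivAt (fun r => (c - r) * lam * Real.exp (-(lam * r)) - Real.exp (-(lam * r)))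
        ((r - c) * (lam ^ 2 * Real.exp (-(lam * r)))) r := by
    intro r _
    have h1 := ((((hasDerivAt_id r).const_sub c).mul_const lam).mul (he r)).sub (he r)
    refine h1.congr_deriv ?_
    simp only [id_eq]
    ring
  rw [hz, zero_add, hmain, intervalIntegral.integral_eq_sub_of_hasDerivAt hderiv
    ((by fun_prop : Continuous fun r : ℝ => (r - c) * (lam ^ 2 * Real.exp (-(lam * r)))
      ).intervalIntegrable _ _)]
  simp only [sub_self, zero_mul, zero_sub]
  ring

/-- `∫ 1_{[p,p+r]} 1_{[q,q+r]} = (r - |p - q|)₊` (the overlap of two intervals of length `r`).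
[folklore] -/
theorem integral_indicator_Icc_mul_indicator_Icc (p q r : ℝ) :
    ∫ u, (Set.Icc p (p + r)).indicator (1 : ℝ → ℝ) u * (Set.Icc q (q + r)).indicator 1 u
      = max (r - |p - q|) 0 := by
  have h : (fun u => (Set.Icc p (p + r)).indicator (1 : ℝ → ℝ) u
      * (Set.Icc q (q + r)).indicator 1 u)
      = (Set.Icc p (p + r) ∩ Set.Icc q (q + r)).indicator 1 := by
    rw [Set.inter_indicator_one]; rfl
  rw [h, integral_indicator_one (measurableSet_Icc.inter measurableSet_Icc), Set.Icc_inter_Icc,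
    Real.volume_real_Icc]
  congr 1
  rw [show (p + r) ⊓ (q + r) = p ⊓ q + r from min_add_add_right p q r]
  rcases le_total p q with hpq | hpq
  · rw [min_eq_left hpq, max_eq_right hpq, abs_of_nonpos (sub_nonpos.2 hpq)]; ring
  · rw [min_eq_right hpq, max_eq_left hpq, abs_of_nonneg (sub_nonneg.2 hpq)]; ring

/-- Triangle functions are positive definite:
`∑ᵢⱼ wᵢ wⱼ (r - |sᵢ - sⱼ|)₊ = ∫ (∑ᵢ wᵢ 1_{[sᵢ, sᵢ + r]})² ≥ 0`. [folklore] -/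
theorem sum_sum_mul_triangle_nonneg {m : ℕ} (s w : Fin m → ℝ) (r : ℝ) :
    0 ≤ ∑ i, ∑ j, w i * w j * max (r - |s i - s j|) 0 := by
  set box : Fin m → ℝ → ℝ := fun i => (Set.Icc (s i) (s i + r)).indicator 1 with hbox
  have hint : ∀ i j, Integrable (fun u => box i u * box j u) := by
    intro i j
    have h : (fun u => box i u * box j u)
        = (Set.Icc (s i) (s i + r) ∩ Set.Icc (s j) (s j + r)).indicator 1 := by
      rw [hbox, Set.inter_indicator_one]
      rfl
    rw [h, integrable_indicator_iff (measurableSet_Icc.inter measurableSet_Icc)]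
    exact integrableOn_const
      ((measure_mono Set.inter_subset_left).trans_lt measure_Icc_lt_top).ne
  calc (0 : ℝ) ≤ ∫ u, (∑ i, w i * box i u) ^ 2 := integral_nonneg fun u => sq_nonneg _
    _ = ∫ u, ∑ i, ∑ j, w i * w j * (box i u * box j u) := by
        congr 1
        funext u
        rw [sq, Finset.sum_mul_sum]
        exact Finset.sum_congr rfl fun i _ => Finset.sum_congr rfl fun j _ => by ring
    _ = ∑ i, ∑ j, w i * w j * ∫ u, box i u * box j u := by
        rw [integral_finsetSum _ (fun i _ => integrable_finsetSum _ fun j _ =>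
          (hint i j).const_mul _)]
        refine Finset.sum_congr rfl fun i _ => ?_
        rw [integral_finsetSum _ (fun j _ => (hint i j).const_mul _)]
        refine Finset.sum_congr rfl fun j _ => ?_
        exact integral_const_mul _ _
    _ = ∑ i, ∑ j, w i * w j * max (r - |s i - s j|) 0 := by
        refine Finset.sum_congr rfl fun i _ => Finset.sum_congr rfl fun j _ => ?_
        rw [hbox, integral_indicator_Icc_mul_indicator_Icc]

/-- **Pólya lower bound** (the coercive archimedean terms). For `∑ wᵢ = 0` and `|sᵢ| < a`:
`∑ᵢⱼ wᵢ wⱼ e^{-λ|sᵢ - sⱼ|} ≥ 2λ e^{-2aλ} ∫_{-a}^{a} (∑ᵢ wᵢ 1[u ≤ sᵢ])² du` (the tangent-line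
part of `exp_neg_mul_abs_eq_integral` contributes exactly `2λe^{-2aλ}E` by the energy identity,
the triangle part is non-negative). [folklore] -/
theorem sum_sum_mul_exp_ge {m : ℕ} {a : ℝ} (ha : 0 < a) (lam : ℝ) (s w : Fin m → ℝ)
    (hs : ∀ i, |s i| < a) (hw : ∑ i, w i = 0)
    (hE : ∑ i, ∑ j, w i * w j * |s i - s j|
      = -2 * ∫ u in (-a)..a, (∑ i, (if u ≤ s i then w i else 0)) ^ 2) :
    2 * lam * Real.exp (-(lam * (2 * a)))
        * ∫ u in (-a)..a, (∑ i, (if u ≤ s i then w i else 0)) ^ 2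
      ≤ ∑ i, ∑ j, w i * w j * Real.exp (-(lam * |s i - s j|)) := by
  have hv : ∀ i j, |s i - s j| ≤ 2 * a := fun i j =>
    (abs_sub _ _).trans (by linarith [hs i, hs j])
  have hexp : ∀ i j, w i * w j * Real.exp (-(lam * |s i - s j|)) =
      w i * w j * (Real.exp (-(lam * (2 * a))) * (1 + lam * (2 * a)))
      + (-(lam * Real.exp (-(lam * (2 * a))))) * (w i * w j * |s i - s j|)
      + w i * w j * ∫ r in (0 : ℝ)..(2 * a),
          max (r - |s i - s j|) 0 * (lam ^ 2 * Real.exp (-(lam * r))) := by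
    intro i j
    rw [exp_neg_mul_abs_eq_integral (hv i j)]
    ring
  have h3 : 0 ≤ ∑ i, ∑ j, w i * w j * ∫ r in (0 : ℝ)..(2 * a),
      max (r - |s i - s j|) 0 * (lam ^ 2 * Real.exp (-(lam * r))) := by
    have hcont : ∀ i j, Continuous fun r : ℝ =>
        w i * w j * max (r - |s i - s j|) 0 * (lam ^ 2 * Real.exp (-(lam * r))) :=
      fun i j => by fun_prop
    have hswap : ∑ i, ∑ j, w i * w j * ∫ r in (0 : ℝ)..(2 * a),
        max (r - |s i - s j|) 0 * (lam ^ 2 * Real.exp (-(lam * r)))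
        = ∫ r in (0 : ℝ)..(2 * a), (∑ i, ∑ j, w i * w j * max (r - |s i - s j|) 0)
            * (lam ^ 2 * Real.exp (-(lam * r))) := by
      simp_rw [← intervalIntegral.integral_const_mul, Finset.sum_mul]
      rw [intervalIntegral.integral_finsetSum (fun i _ =>
        intervalIntegrable_sum_fun _ fun j _ => (hcont i j).intervalIntegrable _ _)]
      refine Finset.sum_congr rfl fun i _ => ?_
      rw [intervalIntegral.integral_finsetSum (fun j _ => (hcont i j).intervalIntegrable _ _)]
      refine Finset.sum_congr rfl fun j _ => ?_
      refine intervalIntegral.integral_congr fun r _ => ?_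
      ring
    rw [hswap]
    exact intervalIntegral.integral_nonneg (by linarith) fun r _ =>
      mul_nonneg (sum_sum_mul_triangle_nonneg s w r) (by positivity)
  simp_rw [hexp, Finset.sum_add_distrib, ← Finset.mul_sum, hE,
    sum_sum_mul_mul_eq_zero_left w hw] at h3 ⊢
  linarith [h3]

/-! ### The quadratic form of `Ψ` on the wall -/

/-- `∑_k 1/λ_k² < ∞` (`λ_k = 2k + 1/2`; `1/λ_k² = (1/4)(k + 1/4)^{-2}`). [folklore] -/
theorem summable_one_div_lam_sq : Summable fun k : ℕ => 1 / (2 * (k : ℝ) + 1 / 2) ^ 2 := by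
  refine (summable_one_div_nat_add_quarter_sq.mul_left (1 / 4)).congr fun k => ?_
  have hk : (2 * (k : ℝ) + 1 / 2) ^ 2 = 4 * ((k : ℝ) + 1 / 4) ^ 2 := by ring
  rw [hk]
  have : ((k : ℝ) + 1 / 4) ^ 2 ≠ 0 := by positivity
  field_simp

/-- The terms `c (1 - e^{-λ_k|v|})/λ_k²` are summable in `k`. [folklore] -/
theorem summable_mul_one_sub_exp_div (c v : ℝ) :
    Summable fun k : ℕ =>
      c * ((1 - Real.exp (-((2 * k + 1 / 2) * |v|))) / (2 * (k : ℝ) + 1 / 2) ^ 2) := by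
  refine (summable_one_div_lam_sq.mul_left |c|).of_norm_bounded (fun k => ?_)
  rw [norm_mul, Real.norm_eq_abs, Real.norm_eq_abs, abs_div,
    abs_of_pos (a := (2 * (k : ℝ) + 1 / 2) ^ 2) (by positivity)]
  refine mul_le_mul_of_nonneg_left ?_ (abs_nonneg c)
  refine div_le_div_of_nonneg_right ?_ (by positivity)
  have h1 : Real.exp (-((2 * k + 1 / 2) * |v|)) ≤ 1 := by
    rw [Real.exp_le_one_iff, neg_nonpos]; positivity
  rw [abs_of_nonneg (sub_nonneg.2 h1)]
  linarith [Real.exp_pos (-((2 * k + 1 / 2) * |v|))]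

/-- **Decomposition of the quadratic form on the wall** (the time-side shadow of
`⟨φ,φ⟩_{G_g,a} = I₀ + I₁ + I_∞` in the proof of Suzuki2023 Thm 4.2, with `I₁ = 0`). For weights
of total mass `0` and points `|sᵢ| < a ≤ (log 2)/2` (so that all differences lie on the
prime-free wall `|v| < log 2`):
`∑ᵢⱼ wᵢwⱼ Ψ(sᵢ - sⱼ) = 8(∑ wᵢ(cosh(sᵢ/2) - 1))² - 8(∑ wᵢ sinh(sᵢ/2))²`
`  - (A/2) ∑ᵢⱼ wᵢwⱼ |sᵢ - sⱼ| - ∑_k λ_k^{-2} ∑ᵢⱼ wᵢwⱼ e^{-λ_k|sᵢ - sⱼ|}`.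
[cite: Suzuki2023, proof of Thm 4.2] -/
theorem sum_sum_mul_zetaScrew_eq {m : ℕ} {a : ℝ} (ha : a ≤ Real.log 2 / 2) (s w : Fin m → ℝ)
    (hs : ∀ i, |s i| < a) (hw : ∑ i, w i = 0) :
    ∑ i, ∑ j, w i * w j * zetaScrew (s i - s j) =
      8 * (∑ i, w i * (Real.cosh (s i / 2) - 1)) ^ 2 - 8 * (∑ i, w i * Real.sinh (s i / 2)) ^ 2
      - (Real.eulerMascheroniConstant + Real.pi / 2 + 3 * Real.log 2 + Real.log Real.pi) / 2
          * ∑ i, ∑ j, w i * w j * |s i - s j|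
      - ∑' k : ℕ, (∑ i, ∑ j, w i * w j * Real.exp (-((2 * k + 1 / 2) * |s i - s j|)))
          / (2 * (k : ℝ) + 1 / 2) ^ 2 := by
  set A : ℝ := Real.eulerMascheroniConstant + Real.pi / 2 + 3 * Real.log 2 + Real.log Real.pi
    with hA
  have hv : ∀ i j, |s i - s j| < Real.log 2 := fun i j =>
    (abs_sub _ _).trans_lt (by linarith [hs i, hs j])
  -- termwise wall formula, distributed
  have hterm : ∀ i j, w i * w j * zetaScrew (s i - s j)
      = 8 * (w i * Real.cosh (s i / 2) * (w j * Real.cosh (s j / 2)))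
        - 8 * (w i * Real.sinh (s i / 2) * (w j * Real.sinh (s j / 2)))
        - 8 * (w i * w j * 1)
        - A / 2 * (w i * w j * |s i - s j|)
        + w i * w j * ∑' k : ℕ, (1 - Real.exp (-((2 * k + 1 / 2) * |s i - s j|)))
            / (2 * (k : ℝ) + 1 / 2) ^ 2 := by
    intro i j
    rw [zetaScrew_eq_cosh_tsum (hv i j), sub_div, Real.cosh_sub]
    ring
  have hcosh : ∑ i, w i * Real.cosh (s i / 2) = ∑ i, w i * (Real.cosh (s i / 2) - 1) := by
    rw [← sub_eq_zero, ← Finset.sum_sub_distrib]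
    simp_rw [show ∀ i, w i * Real.cosh (s i / 2) - w i * (Real.cosh (s i / 2) - 1) = w i from
      fun i => by ring]
    exact hw
  -- the series term: interchange with the finite sums
  have hswap : ∑ i, ∑ j, w i * w j * ∑' k : ℕ, (1 - Real.exp (-((2 * k + 1 / 2) * |s i - s j|)))
        / (2 * (k : ℝ) + 1 / 2) ^ 2
      = ∑' k : ℕ, ∑ i, ∑ j, w i * w j * ((1 - Real.exp (-((2 * k + 1 / 2) * |s i - s j|)))
        / (2 * (k : ℝ) + 1 / 2) ^ 2) := by
    rw [Summable.tsum_finsetSum (fun i _ => summable_sum fun j _ =>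
      summable_mul_one_sub_exp_div (w i * w j) (s i - s j))]
    refine Finset.sum_congr rfl fun i _ => ?_
    rw [Summable.tsum_finsetSum (fun j _ =>
      summable_mul_one_sub_exp_div (w i * w j) (s i - s j))]
    refine Finset.sum_congr rfl fun j _ => ?_
    exact tsum_mul_left.symm
  have hk : ∀ k : ℕ, ∑ i, ∑ j, w i * w j * ((1 - Real.exp (-((2 * k + 1 / 2) * |s i - s j|)))
        / (2 * (k : ℝ) + 1 / 2) ^ 2)
      = -((∑ i, ∑ j, w i * w j * Real.exp (-((2 * k + 1 / 2) * |s i - s j|)))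
          / (2 * (k : ℝ) + 1 / 2) ^ 2) := by
    intro k
    have e : ∀ i j, w i * w j * ((1 - Real.exp (-((2 * k + 1 / 2) * |s i - s j|)))
        / (2 * (k : ℝ) + 1 / 2) ^ 2)
        = (1 / (2 * (k : ℝ) + 1 / 2) ^ 2) * (w i * w j * 1)
          + (-(1 / (2 * (k : ℝ) + 1 / 2) ^ 2))
            * (w i * w j * Real.exp (-((2 * k + 1 / 2) * |s i - s j|))) := by
      intro i j; ring
    simp_rw [e, Finset.sum_add_distrib, ← Finset.mul_sum,
      sum_sum_mul_mul_eq_zero_left w hw (fun _ => 1)]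
    ring
  rw [Finset.sum_congr rfl fun i _ => Finset.sum_congr rfl fun j _ => hterm i j]
  simp only [Finset.sum_add_distrib, Finset.sum_sub_distrib]
  have e1 : ∑ i, ∑ j, 8 * (w i * Real.cosh (s i / 2) * (w j * Real.cosh (s j / 2)))
      = 8 * (∑ i, w i * (Real.cosh (s i / 2) - 1)) ^ 2 := by
    rw [← hcosh, sq, Finset.sum_mul_sum, Finset.mul_sum]
    refine Finset.sum_congr rfl fun i _ => ?_
    rw [Finset.mul_sum]
  have e2 : ∑ i, ∑ j, 8 * (w i * Real.sinh (s i / 2) * (w j * Real.sinh (s j / 2)))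
      = 8 * (∑ i, w i * Real.sinh (s i / 2)) ^ 2 := by
    rw [sq, Finset.sum_mul_sum, Finset.mul_sum]
    refine Finset.sum_congr rfl fun i _ => ?_
    rw [Finset.mul_sum]
  have e3 : ∑ i, ∑ j, 8 * (w i * w j * 1) = 0 := by
    have h : ∑ i, ∑ j, 8 * (w i * w j * 1) = 8 * ∑ i, ∑ j, w i * w j * 1 := by
      rw [Finset.mul_sum]
      refine Finset.sum_congr rfl fun i _ => ?_
      rw [Finset.mul_sum]
    rw [h, sum_sum_mul_mul_eq_zero_left w hw (fun _ => 1), mul_zero]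
  have e4 : ∑ i, ∑ j, A / 2 * (w i * w j * |s i - s j|)
      = A / 2 * ∑ i, ∑ j, w i * w j * |s i - s j| := by
    rw [Finset.mul_sum]
    refine Finset.sum_congr rfl fun i _ => ?_
    rw [Finset.mul_sum]
  have e5 : ∑ i, ∑ j, w i * w j * ∑' k : ℕ, (1 - Real.exp (-((2 * k + 1 / 2) * |s i - s j|)))
        / (2 * (k : ℝ) + 1 / 2) ^ 2
      = -∑' k : ℕ, (∑ i, ∑ j, w i * w j * Real.exp (-((2 * k + 1 / 2) * |s i - s j|)))
          / (2 * (k : ℝ) + 1 / 2) ^ 2 := by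
    rw [hswap, ← tsum_neg]
    exact tsum_congr hk
  linear_combination e1 - e2 - e3 - e4 + e5

/-! ### Bounds and the conditional negativity of `Ψ` on small configurations -/

/-- `|sinh x| ≤ e^{|x|}/2`. [folklore] -/
theorem abs_sinh_le (x : ℝ) : |Real.sinh x| ≤ Real.exp |x| / 2 := by
  rw [Real.sinh_eq, abs_div, abs_two]
  refine div_le_div_of_nonneg_right ?_ zero_le_two
  have h1 : Real.exp x ≤ Real.exp |x| := Real.exp_le_exp.2 (le_abs_self x)
  have h2 : Real.exp (-x) ≤ Real.exp |x| := Real.exp_le_exp.2 (neg_le_abs x)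
  rw [abs_sub_le_iff]
  constructor <;> linarith [Real.exp_pos x, Real.exp_pos (-x)]

/-- The pole ("archimedean `g₀`") error term: for `∑ wᵢ = 0`, `|sᵢ| ≤ a`,
`8 (∑ wᵢ (cosh(sᵢ/2) - 1))² ≤ a e^{a} ∫_{-a}^{a} (∑ wᵢ 1[u ≤ sᵢ])² du`
(summation by parts with `g(u) = cosh(u/2) - 1`, then Cauchy–Schwarz and
`sinh²(u/2)/4 ≤ e^{a}/16` on `[-a, a]`). [folklore] -/
theorem cosh_term_le {m : ℕ} {a : ℝ} (ha : 0 ≤ a) (s w : Fin m → ℝ) (hs : ∀ i, |s i| ≤ a)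
    (hw : ∑ i, w i = 0) :
    8 * (∑ i, w i * (Real.cosh (s i / 2) - 1)) ^ 2
      ≤ a * Real.exp a * ∫ u in (-a)..a, (∑ i, (if u ≤ s i then w i else 0)) ^ 2 := by
  have hderiv : ∀ u : ℝ,
      HasDerivAt (fun u => Real.cosh (u / 2) - 1) (Real.sinh (u / 2) / 2) u := by
    intro u
    have h := (((hasDerivAt_id u).div_const 2).cosh).sub_const 1
    simp only [id_eq] at h
    exact h.congr_deriv (by ring)
  have hcont : Continuous fun u : ℝ => Real.sinh (u / 2) / 2 := by fun_prop
  rw [sum_mul_eq_integral_deriv_mul_stepSum s w hs hw hderiv hcont]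
  have haa : -a ≤ a := by linarith
  have hCS := sq_integral_mul_le haa (f := fun u => Real.sinh (u / 2) / 2)
    (g := fun u => ∑ i, (if u ≤ s i then w i else 0))
    ((by fun_prop : Continuous fun u : ℝ => (Real.sinh (u / 2) / 2) ^ 2).intervalIntegrable _ _)
    (intervalIntegrable_stepSum_sq s w _ _)
    ((intervalIntegrable_stepSum s w _ _).continuousOn_mul hcont.continuousOn)
  have hf2 : ∫ u in (-a)..a, (Real.sinh (u / 2) / 2) ^ 2 ≤ Real.exp a / 16 * (2 * a) := by
    have h := intervalIntegral.norm_integral_le_of_norm_le_const (a := -a) (b := a)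
      (f := fun u => (Real.sinh (u / 2) / 2) ^ 2) (C := Real.exp a / 16) (fun u hu => ?_)
    · rw [Real.norm_eq_abs, show a - -a = 2 * a by ring,
        abs_of_nonneg (by linarith : (0 : ℝ) ≤ 2 * a)] at h
      exact (le_abs_self _).trans h
    · rw [Set.uIoc_of_le haa] at hu
      have hu' : |u| ≤ a := abs_le.2 ⟨hu.1.le, hu.2⟩
      rw [Real.norm_eq_abs, abs_pow, abs_div, abs_two, div_pow]
      have hs1 : |Real.sinh (u / 2)| ≤ Real.exp (a / 2) / 2 := by
        refine (abs_sinh_le _).trans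
          (div_le_div_of_nonneg_right (Real.exp_le_exp.2 ?_) zero_le_two)
        rw [abs_div, abs_two]
        linarith
      have hs2 : |Real.sinh (u / 2)| ^ 2 ≤ (Real.exp (a / 2) / 2) ^ 2 :=
        pow_le_pow_left₀ (abs_nonneg _) hs1 2
      have he : Real.exp (a / 2) ^ 2 = Real.exp a := by rw [← Real.exp_nat_mul]; ring_nf
      nlinarith [he, hs2]
  have hE : 0 ≤ ∫ u in (-a)..a, (∑ i, (if u ≤ s i then w i else 0)) ^ 2 :=
    intervalIntegral.integral_nonneg haa fun u _ => sq_nonneg _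
  calc 8 * (∫ u in (-a)..a, Real.sinh (u / 2) / 2 * ∑ i, (if u ≤ s i then w i else 0)) ^ 2
      ≤ 8 * ((∫ u in (-a)..a, (Real.sinh (u / 2) / 2) ^ 2)
          * ∫ u in (-a)..a, (∑ i, (if u ≤ s i then w i else 0)) ^ 2) := by linarith [hCS]
    _ ≤ 8 * ((Real.exp a / 16 * (2 * a))
          * ∫ u in (-a)..a, (∑ i, (if u ≤ s i then w i else 0)) ^ 2) := by gcongr
    _ = a * Real.exp a * ∫ u in (-a)..a, (∑ i, (if u ≤ s i then w i else 0)) ^ 2 := by ring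

/-- **`Ψ` is conditionally negative definite on small configurations** (quantitative core of
Suzuki2023 Thm 4.2 in matrix form). If `∑_{k<K} 2/λ_k ≥ A + 2` and
`0 < a ≤ min((log 2)/2, 1/(4(K+1)))`, then for all points `|sᵢ| < a` and real weights with
`∑ wᵢ = 0`: `∑ᵢⱼ wᵢ wⱼ Ψ(sᵢ - sⱼ) ≤ 0`. Indeed, with `E = ∫_{-a}^{a} (∑ wᵢ 1[u ≤ sᵢ])² ≥ 0`,
`∑ᵢⱼ wᵢwⱼ Ψ(sᵢ - sⱼ) ≤ (log 2) E + A E - (∑_{k<K} 2/λ_k - 4aK) E ≤ (log 2 - 1) E ≤ 0`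
(`sum_sum_mul_zetaScrew_eq`, `cosh_term_le`, `sum_sum_mul_abs_sub_eq`, `sum_sum_mul_exp_ge`,
`e^{-x} ≥ 1 - x`). The mechanism — the archimedean part is coercive and beats the linear and
pole parts once `a` is small — is that of the printed proof. [cite: Suzuki2023, Thm 4.2 (proof)] -/
theorem sum_sum_mul_zetaScrew_nonpos {K : ℕ}
    (hK : Real.eulerMascheroniConstant + Real.pi / 2 + 3 * Real.log 2 + Real.log Real.pi + 2
      ≤ ∑ k ∈ Finset.range K, 2 / (2 * (k : ℝ) + 1 / 2))
    {a : ℝ} (ha : 0 < a) (ha₁ : a ≤ Real.log 2 / 2) (ha₂ : a ≤ 1 / (4 * ((K : ℝ) + 1)))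
    {m : ℕ} (s w : Fin m → ℝ) (hs : ∀ i, |s i| < a) (hw : ∑ i, w i = 0) :
    ∑ i, ∑ j, w i * w j * zetaScrew (s i - s j) ≤ 0 := by
  set E : ℝ := ∫ u in (-a)..a, (∑ i, (if u ≤ s i then w i else 0)) ^ 2 with hEdef
  have hs' : ∀ i, |s i| ≤ a := fun i => (hs i).le
  have haa : -a ≤ a := by linarith
  have hE0 : 0 ≤ E := intervalIntegral.integral_nonneg haa fun u _ => sq_nonneg _
  have hEabs := sum_sum_mul_abs_sub_eq s w hs' hw
  -- the exponential sums `q k = ∑ᵢⱼ wᵢwⱼ e^{-λ_k|sᵢ - sⱼ|}` and their lower bounds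
  set q : ℕ → ℝ := fun k => ∑ i, ∑ j, w i * w j * Real.exp (-((2 * k + 1 / 2) * |s i - s j|))
    with hq
  have hqE : ∀ k : ℕ, 2 * (2 * k + 1 / 2) * Real.exp (-((2 * k + 1 / 2) * (2 * a))) * E ≤ q k :=
    fun k => sum_sum_mul_exp_ge ha _ s w hs hw hEabs
  have hq0 : ∀ k, 0 ≤ q k := fun k => (by positivity : (0 : ℝ) ≤ 2 * (2 * k + 1 / 2)
    * Real.exp (-((2 * k + 1 / 2) * (2 * a))) * E).trans (hqE k)
  have hqsum : Summable fun k : ℕ => q k / (2 * (k : ℝ) + 1 / 2) ^ 2 := by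
    refine (summable_one_div_lam_sq.mul_left (∑ i, ∑ j, |w i| * |w j|)).of_norm_bounded
      (fun k => ?_)
    rw [Real.norm_eq_abs, abs_div, abs_of_pos (a := (2 * (k : ℝ) + 1 / 2) ^ 2) (by positivity),
      mul_one_div]
    refine div_le_div_of_nonneg_right ?_ (by positivity)
    refine (Finset.abs_sum_le_sum_abs _ _).trans (Finset.sum_le_sum fun i _ =>
      (Finset.abs_sum_le_sum_abs _ _).trans (Finset.sum_le_sum fun j _ => ?_))
    rw [abs_mul, abs_mul]
    refine mul_le_of_le_one_right (by positivity) ?_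
    rw [Real.abs_exp, Real.exp_le_one_iff, neg_nonpos]
    positivity
  -- partial sums of the (non-negative) series, and `e^{-x} ≥ 1 - x`
  have htsum : (∑ k ∈ Finset.range K, 2 / (2 * (k : ℝ) + 1 / 2) - 4 * a * K) * E
      ≤ ∑' k : ℕ, q k / (2 * (k : ℝ) + 1 / 2) ^ 2 := by
    refine le_trans ?_ (hqsum.sum_le_tsum (Finset.range K) fun k _ => div_nonneg (hq0 k)
      (by positivity))
    rw [sub_mul, Finset.sum_mul]
    have hKsum : 4 * a * K * E = ∑ k ∈ Finset.range K, 4 * a * E := by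
      rw [Finset.sum_const, Finset.card_range, nsmul_eq_mul]; ring
    rw [hKsum, ← Finset.sum_sub_distrib]
    refine Finset.sum_le_sum fun k _ => ?_
    have h1 : 2 / (2 * (k : ℝ) + 1 / 2) * E - 4 * a * E
        = 2 * (2 * k + 1 / 2) * (1 + -((2 * k + 1 / 2) * (2 * a))) * E
          / (2 * (k : ℝ) + 1 / 2) ^ 2 := by
      field_simp
      ring
    rw [h1]
    refine div_le_div_of_nonneg_right ?_ (by positivity)
    refine le_trans ?_ (hqE k)
    have h2 := Real.add_one_le_exp (-((2 * k + 1 / 2) * (2 * a)))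
    have h3 : 0 ≤ 2 * (2 * (k : ℝ) + 1 / 2) * E := by positivity
    nlinarith [h2, h3]
  -- the pole term
  have hcoshle : 8 * (∑ i, w i * (Real.cosh (s i / 2) - 1)) ^ 2 ≤ Real.log 2 * E := by
    refine (cosh_term_le ha.le s w hs' hw).trans (mul_le_mul_of_nonneg_right ?_ hE0)
    have h1 : Real.exp a ≤ 2 := by
      calc Real.exp a ≤ Real.exp (Real.log 2) :=
            Real.exp_le_exp.2 (by linarith [Real.log_pos one_lt_two])
        _ = 2 := Real.exp_log two_pos
    nlinarith [Real.exp_pos a, h1]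
  -- assemble
  rw [sum_sum_mul_zetaScrew_eq ha₁ s w hs hw, hEabs]
  have h4aK : 4 * a * K ≤ 1 := by
    have hK1 : (0 : ℝ) < 4 * ((K : ℝ) + 1) := by positivity
    have := (le_div_iff₀ hK1).1 ha₂
    nlinarith
  have hsinh : 0 ≤ 8 * (∑ i, w i * Real.sinh (s i / 2)) ^ 2 := by positivity
  have hlog : Real.log 2 < 1 := by
    rw [Real.log_lt_iff_lt_exp two_pos]
    linarith [Real.add_one_lt_exp one_ne_zero]
  nlinarith [htsum, hcoshle, hsinh, hE0, h4aK, hK, mul_nonneg hE0 ha.le]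

end Suzuki2023Thm42

open Suzuki2023Thm42 in
/-- **Suzuki2023 Thm 4.2, "in particular" clause** (discharge of `Suzuki2023_thm42_screw`):
there is `a₀ > 0` such that for every `0 < a < a₀` the kernel `G_g(t,u) = Ψ(t) + Ψ(u) - Ψ(t-u)`
of `g = -Ψ` is non-negative definite on `(-a, a)` (Suzuki2023 (1.5)), i.e.
`g|_{[-2a,2a]} ∈ 𝒢_a`.

Proof (the mechanism of Suzuki2023 §4.3 — for small `a` the archimedean part of `Ψ` is coercive
and dominates the linear and pole parts — made elementary on the time side; see the module
docstring): reduce to real coefficients (`isPosSemidefKernelOn_zetaScrewKernel_iff`), augment the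
configuration by `t₀ = 0` with weight `-∑ xᵢ` (`sum_sum_zetaScrewKernel_eq_neg`), and apply
`sum_sum_mul_zetaScrew_nonpos` with `K` given by the divergence of `∑ 2/λ_k ≥ ∑ 1/(k+1)` and
`a₀ = min((log 2)/2, 1/(4(K+1)))`. [cite: Suzuki2023, Thm 4.2] -/
theorem Suzuki2023_thm42_screw_holds : Suzuki2023_thm42_screw := by
  set A : ℝ := Real.eulerMascheroniConstant + Real.pi / 2 + 3 * Real.log 2 + Real.log Real.pi
    with hA
  obtain ⟨K, hK⟩ : ∃ K : ℕ, A + 2 ≤ ∑ k ∈ Finset.range K, 2 / (2 * (k : ℝ) + 1 / 2) := by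
    obtain ⟨K, hK⟩ :=
      (Real.tendsto_sum_range_one_div_nat_succ_atTop.eventually_ge_atTop (A + 2)).exists
    refine ⟨K, hK.trans (Finset.sum_le_sum fun k _ => ?_)⟩
    rw [div_le_div_iff₀ (by positivity) (by positivity)]
    linarith
  refine ⟨min (Real.log 2 / 2) (1 / (4 * ((K : ℝ) + 1))),
    lt_min (by linarith [Real.log_pos one_lt_two]) (by positivity), fun a ha ha' => ?_⟩
  rw [isPosSemidefKernelOn_zetaScrewKernel_iff]
  intro N t x ht
  rw [sum_sum_zetaScrewKernel_eq_neg, neg_nonneg]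
  refine sum_sum_mul_zetaScrew_nonpos hK ha (ha'.le.trans (min_le_left _ _))
    (ha'.le.trans (min_le_right _ _)) (Fin.cons 0 t) (Fin.cons (-∑ i, x i) x) ?_ ?_
  · intro i
    refine Fin.cases ?_ (fun i => ?_) i
    · simpa using ha
    · simpa only [Fin.cons_succ] using abs_lt.2 (ht i)
  · simp [Fin.sum_cons]

end Literature.NumberTheory.LFunctions
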